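import Mathlib.Algebra.FreeAbelianGroup.Finsupp
import Mathlib.GroupTheory.FreeGroup.IsFreeGroup
import Mathlib.GroupTheory.Abelianization.Defs
import Mathlib.LinearAlgebra.Dimension.Constructions
import Mathlib.LinearAlgebra.FreeModule.StrongRankCondition
import Mathlib.LinearAlgebra.FreeModule.Finite.Basic
import Mathlib.LinearAlgebra.Finsupp.LinearCombination
import Mathlib.LinearAlgebra.Quotient.Basic
import HarnessLib

/-!
# The abelianisation as a `ℤ`-module: rank of a free group's abelianisation, and the abelianisation
# of a quotient

Topic `Literature/GroupTheory/CombinatorialGroupTheory`; theorems only.  Elementary bookkeeping that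
turns group-theoretic data into `ℤ`-linear algebra on `V(G) := Additive (Abelianization G)`:

* `nonempty_additive_abelianization_linearEquiv_fun` — a free basis `ι` of `G` (`FreeGroupBasis ι G`,
  `ι` finite) gives `V(G) ≃ₗ[ℤ] (ι → ℤ)`; hence `finrank ℤ V(G) = |ι|` and `V(G)` is a finite
  `ℤ`-module (`finrank_additive_abelianization_eq_card`);
* `span_image_normalClosure_eq` — in `V(G)` the span of the image of a normal closure `⟪S⟫` is the
  span of the image of `S` (conjugation is invisible in the abelianisation);
* `ker_abelianizationMap_eq_span` — for a surjection `π : G ↠ K`, the kernel of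
  `V(π) : V(G) → V(K)` is the span of the image of `ker π`; with `V(π)` onto
  (`abelianizationMap_surjective`), so `V(G) / span(image of ker π) ≅ V(K)`
  (`nonempty_abelianization_quotient_linearEquiv`) — the right end `H₁(G) → H₁(K) → 0` of the five-term sequence
  (K. S. Brown, *Cohomology of Groups*, II §5 Ex. 6 / VII (6.4)).

Used by the surface-group covering-degree computation.  No definitions.
-/

namespace Literature.GroupTheory.CombinatorialGroupTheory

universe u v

/-! ### The abelianisation of a free group of finite rank -/

/-- A free basis `ι` of `G` identifies `Additive (Abelianization G)` with `ι → ℤ` (`ι` finite), as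
`ℤ`-modules. [cite: Brown1982CohomologyGroups, II §5 Ex 6] -/
theorem nonempty_additive_abelianization_linearEquiv_fun {G : Type u} [Group G] {ι : Type u}
    [Finite ι] (b : FreeGroupBasis ι G) :
    Nonempty (Additive (Abelianization G) ≃ₗ[ℤ] (ι → ℤ)) := by
  -- `Abelianization G ≃* Abelianization (FreeGroup ι)`, whose additive version IS `FreeAbelianGroup ι`
  let e₁ : Additive (Abelianization G) ≃+ FreeAbelianGroup ι :=
    MulEquiv.toAdditive b.repr.abelianizationCongr
  let e₂ : FreeAbelianGroup ι ≃+ (ι →₀ ℤ) := FreeAbelianGroup.equivFinsupp ι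
  let e₃ : (ι →₀ ℤ) ≃ₗ[ℤ] (ι → ℤ) := Finsupp.linearEquivFunOnFinite ℤ ℤ ι
  exact ⟨((e₁.trans e₂).toIntLinearEquiv).trans e₃⟩

/-- With a finite free basis `ι`: `finrank ℤ (Additive (Abelianization G)) = |ι|`, and the module is
finite. [cite: Brown1982CohomologyGroups, II §5 Ex 6] -/
theorem finrank_additive_abelianization_eq_card {G : Type u} [Group G] {ι : Type u} [Finite ι]
    (b : FreeGroupBasis ι G) :
    Module.finrank ℤ (Additive (Abelianization G)) = Nat.card ι ∧
      Module.Finite ℤ (Additive (Abelianization G)) := by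
  obtain ⟨e⟩ := nonempty_additive_abelianization_linearEquiv_fun b
  haveI := Fintype.ofFinite ι
  refine ⟨?_, Module.Finite.equiv e.symm⟩
  rw [e.finrank_eq, Module.finrank_fintype_fun_eq_card, Nat.card_eq_fintype_card]

/-! ### Spans of images in the abelianisation -/

/-- In `Additive (Abelianization G)` the span of the image of a normal closure `⟪S⟫` equals the span
of the image of `S`: the image of a conjugate `c s c⁻¹` is the image of `s`.
[cite: Brown1982CohomologyGroups, II §5 Ex 6] -/
theorem span_image_normalClosure_eq {G : Type u} [Group G] (S : Set G) :
    Submodule.span ℤ ((fun x : G => Additive.ofMul (Abelianization.of x)) ''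
        (Subgroup.normalClosure S : Set G)) =
      Submodule.span ℤ ((fun x : G => Additive.ofMul (Abelianization.of x)) '' S) := by
  refine le_antisymm ?_ (Submodule.span_mono (Set.image_mono Subgroup.subset_normalClosure))
  rw [Submodule.span_le]
  rintro _ ⟨x, hx, rfl⟩
  change x ∈ Subgroup.closure (Group.conjugatesOfSet S) at hx
  induction hx using Subgroup.closure_induction with
  | mem y hy =>
    obtain ⟨s, hs, hc⟩ := Group.mem_conjugatesOfSet_iff.mp hy
    obtain ⟨c, rfl⟩ := isConj_iff.mp hc
    have : Abelianization.of (c * s * c⁻¹) = Abelianization.of (G := G) s := by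
      rw [map_mul, map_mul, map_inv, mul_inv_cancel_comm]
    dsimp only
    rw [SetLike.mem_coe, this]
    exact Submodule.subset_span ⟨s, hs, rfl⟩
  | one => simp
  | mul y z _ _ hy hz =>
    dsimp only at hy hz ⊢
    rw [SetLike.mem_coe, map_mul, ofMul_mul]
    exact Submodule.add_mem _ hy hz
  | inv y _ hy =>
    dsimp only at hy ⊢
    rw [SetLike.mem_coe, map_inv, ofMul_inv]
    exact Submodule.neg_mem _ hy

/-! ### The abelianisation of a quotient -/

/-- The `ℤ`-linear map `Additive (Abelianization G) → Additive (Abelianization K)` induced by a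
surjection `π : G ↠ K` is onto. [cite: Brown1982CohomologyGroups, II §5 Ex 6] -/
theorem abelianizationMap_surjective {G : Type u} [Group G] {K : Type v} [Group K] (π : G →* K)
    (hπ : Function.Surjective π) :
    Function.Surjective ((MonoidHom.toAdditive (Abelianization.map π)).toIntLinearMap) := by
  intro y
  obtain ⟨y, rfl⟩ := Additive.ofMul.surjective y
  refine QuotientGroup.induction_on y fun k => ?_
  obtain ⟨x, rfl⟩ := hπ k
  refine ⟨Additive.ofMul (Abelianization.of x), ?_⟩
  change Additive.ofMul (Abelianization.map π (Abelianization.of x)) = _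
  rw [Abelianization.map_of]
  rfl

/-- For a surjection `π : G ↠ K`, the kernel of `Additive (Abelianization G) → Additive
(Abelianization K)` is the span of the image of `ker π` (exactness of `H₁(G) → H₁(K) → 0` with
the image of `ker π`; Brown II §5 Ex. 6 / VII (6.4)). [cite: Brown1982CohomologyGroups, II §5 Ex 6] -/
theorem ker_abelianizationMap_eq_span {G : Type u} [Group G] {K : Type v} [Group K] (π : G →* K)
    (hπ : Function.Surjective π) :
    LinearMap.ker ((MonoidHom.toAdditive (Abelianization.map π)).toIntLinearMap) =
      Submodule.span ℤ ((fun x : G => Additive.ofMul (Abelianization.of x)) '' (π.ker : Set G)) := by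
  refine le_antisymm ?_ ?_
  · intro v hx
    obtain ⟨y, rfl⟩ := Additive.ofMul.surjective v
    induction y using QuotientGroup.induction_on with
    | H x =>
      rw [LinearMap.mem_ker] at hx
      have hx' : Abelianization.of (π x) = 1 := by
        rw [← Abelianization.map_of π x]
        exact hx
      -- `π x ∈ [K, K] = π [G, G]`: write `π x = π c` with `c ∈ [G, G]`
      have hmem : π x ∈ commutator K := by
        rw [← Abelianization.ker_of]; exact hx'
      have hcomm : commutator K = (commutator G).map π := by
        rw [commutator_def, commutator_def, Subgroup.map_commutator, ← MonoidHom.range_eq_map,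
          MonoidHom.range_eq_top.mpr hπ]
      rw [hcomm] at hmem
      obtain ⟨c, hc, hcx⟩ := hmem
      -- `x = (x c⁻¹) c` with `x c⁻¹ ∈ ker π`
      have hk : x * c⁻¹ ∈ π.ker := by
        rw [MonoidHom.mem_ker, map_mul, map_inv, ← hcx, mul_inv_cancel]
      have hxeq : Additive.ofMul (Abelianization.of x) =
          Additive.ofMul (Abelianization.of (x * c⁻¹)) + Additive.ofMul (Abelianization.of c) := by
        rw [← ofMul_mul, ← map_mul, inv_mul_cancel_right]
      have hc0 : Additive.ofMul (Abelianization.of c) = 0 := by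
        rw [ofMul_eq_zero, ← MonoidHom.mem_ker, Abelianization.ker_of]; exact hc
      change Additive.ofMul (Abelianization.of x) ∈ _
      rw [hxeq, hc0, add_zero]
      exact Submodule.subset_span ⟨x * c⁻¹, hk, rfl⟩
  · rw [Submodule.span_le]
    rintro _ ⟨x, hx, rfl⟩
    rw [SetLike.mem_coe, LinearMap.mem_ker]
    have : π x = 1 := hx
    simp [Abelianization.map_of, this]

/-- For a surjection `π : G ↠ K`: `Additive (Abelianization G)` modulo the span of the image of
`ker π` is `ℤ`-linearly isomorphic to `Additive (Abelianization K)`.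
[cite: Brown1982CohomologyGroups, II §5 Ex 6] -/
theorem nonempty_abelianization_quotient_linearEquiv {G : Type u} [Group G] {K : Type v} [Group K] (π : G →* K)
    (hπ : Function.Surjective π) :
    Nonempty ((Additive (Abelianization G) ⧸
        Submodule.span ℤ ((fun x : G => Additive.ofMul (Abelianization.of x)) '' (π.ker : Set G))) ≃ₗ[ℤ]
      Additive (Abelianization K)) := by
  rw [← ker_abelianizationMap_eq_span π hπ]
  exact ⟨LinearMap.quotKerEquivOfSurjective _ (abelianizationMap_surjective π hπ)⟩

end Literature.GroupTheory.CombinatorialGroupTheory
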